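import Summits.ResolutionOfSingularities.ResolutionOfSingularities.Theorems.WildConesClassicalRegimesDefs
import Literature.RingTheory.RegularLocalRing.SopRegular
import Literature.AlgebraicGeometry.Resolution.PowerSeriesRegularLocal
import Literature.RingTheory.MvPowerSeries.FiniteColength
import Literature.RingTheory.Length.ColengthFinrank

/-!
# Route `JacobianBudget`, crux `IsolatedJacobianDrop` (stmt-ResolutionOfSingularities-18946), line
# `euler-noether`: stub `stub_polarAdditivity` (S4) — polar additivity of colengths

In `R = L⟦u₁, …, uₙ⟧` (`L` a field), for `k < n` series `g₁, …, g_k` and two series `x, y` such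
that `R ⧸ (g, x)` and `R ⧸ (g, y)` are finite-dimensional over `L`, we prove
`dim_L R ⧸ (g, x·y) = dim_L R ⧸ (g, x) + dim_L R ⧸ (g, y)`.

Argument (commutative algebra of complete intersections, all ingredients in the tree).
* The key input is that `x` is a non-zero-divisor modulo `(g)`: `x·r ∈ (g) ⇒ r ∈ (g)`
  (`PolarAdditivity.mem_of_mul_mem`). If some `gᵢ` or `x` is a unit this is trivial. Otherwise
  `g₁, …, g_k, x ∈ 𝔪` generate an ideal of finite colength, hence containing a power of `𝔪`
  (`Jets.exists_maximalIdeal_pow_le_of_finite_quotient`); as `R` is a regular local ring of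
  dimension `n` (`isRegularLocalRing_mvPowerSeries`, `ringKrullDim_mvPowerSeries`), Krull
  (`ringKrullDim_le_length_of_maximalIdeal_pow_le`) forces `n ≤ k + 1`, so `k + 1 = n` (the case
  `k + 1 < n` is vacuous) and `g₁, …, g_k, x` is a system of parameters, hence a regular sequence
  (`isRegular_of_maximalIdeal_pow_le_ofList`, Matsumura Thm. 17.4 (iii)); its last step says
  precisely that `x` is regular on `R ⧸ (g)`.
* Given that, with `K = (g, x·y)` one has `K : x = (g, y)` and `K + (x) = (g, x)`, so the exact
  colon sequence `0 → R⧸(K : x) →·x R⧸K → R⧸(K + (x)) → 0`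
  (`Length.finrank_quotient_eq_colon_add`) gives the additivity
  (`PolarAdditivity.finrank_quotient_sup_span_mul_eq`), once `R ⧸ K` is known to be finite over
  `L`: `(g, x)·(g, y) ≤ K` contains `𝔪ᴺ⁺ᴺ'` and `R ⧸ 𝔪ᴹ` is finite
  (`Jets.finite_quotient_maximalIdeal_pow`, `Length.finite_quotient_of_le`).

Sources: folklore (additivity of intersection multiplicities of complete intersections in a factor,
Lê–Teissier shape); H. Matsumura, *Commutative Ring Theory*, Thm. 17.4 (iii) for "a system of
parameters of a regular local ring is a regular sequence" (tree: `SopRegular.lean`).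
-/

noncomputable section

set_option linter.dupNamespace false

open scoped BigOperators Classical

open Summit.ResolutionOfSingularities.ResolutionOfSingularities.Theorems.WildCones
  (clean bl ord dv tr step run ser pd jac Isol MultP mu)

namespace Summit.ResolutionOfSingularities.ResolutionOfSingularities.Theorems.JacobianBudget

namespace PolarAdditivity

open IsLocalRing RingTheory.Sequence Module
open Literature.RingTheory.RegularLocalRing Literature.AlgebraicGeometry.Resolution
  Literature.RingTheory.MvPowerSeries.Jets Literature.RingTheory.Length

/-! ## Pure algebra: additivity from a non-zero-divisor -/

section Algebra

variable {κ : Type*} [Field κ] {A : Type*} [CommRing A] [Algebra κ A]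

/-- If `x` is a non-zero-divisor modulo `J` then `(J + (x·y)) : x = J + (y)`. [folklore] -/
theorem colon_sup_span_mul_eq (J : Ideal A) {x : A} (y : A)
    (hx : ∀ r : A, x * r ∈ J → r ∈ J) :
    (J ⊔ Ideal.span {x * y}).colon {x} = J ⊔ Ideal.span {y} := by
  apply le_antisymm
  · intro a ha
    rw [Submodule.mem_colon_singleton, smul_eq_mul] at ha
    rcases Submodule.mem_sup.mp ha with ⟨j, hj, s, hs, hjs⟩
    obtain ⟨c, rfl⟩ := Ideal.mem_span_singleton'.mp hs
    have hmem : x * (a - c * y) ∈ J := by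
      have : x * (a - c * y) = j := by rw [mul_sub, ← sub_eq_iff_eq_add.mpr hjs.symm]; ring
      rw [this]
      exact hj
    have ha' : a = (a - c * y) + c * y := by ring
    rw [ha']
    exact Submodule.add_mem _ (Ideal.mem_sup_left (hx _ hmem))
      (Ideal.mem_sup_right (Ideal.mem_span_singleton'.mpr ⟨c, rfl⟩))
  · refine sup_le (fun j hj => ?_) ?_
    · rw [Submodule.mem_colon_singleton, smul_eq_mul]
      exact Ideal.mem_sup_left (Ideal.mul_mem_right _ _ hj)
    · rw [Ideal.span_singleton_le_iff_mem, Submodule.mem_colon_singleton, smul_eq_mul]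
      exact Ideal.mem_sup_right (Ideal.mem_span_singleton'.mpr ⟨1, by ring⟩)

/-- `(J + (x·y)) + (x) = J + (x)`. [folklore] -/
theorem sup_span_mul_sup_span_eq (J : Ideal A) (x y : A) :
    (J ⊔ Ideal.span {x * y}) ⊔ Ideal.span {x} = J ⊔ Ideal.span {x} := by
  apply le_antisymm
  · refine sup_le (sup_le le_sup_left ?_) le_sup_right
    rw [Ideal.span_singleton_le_iff_mem]
    exact Ideal.mem_sup_right (Ideal.mem_span_singleton'.mpr ⟨y, by ring⟩)
  · exact sup_le_sup_right le_sup_left _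

/-- **Additivity of colengths from a non-zero-divisor.** If `x` is a non-zero-divisor modulo `J`
and `A ⧸ (J + (x·y))` is finite over `κ`, then
`dim A ⧸ (J + (x·y)) = dim A ⧸ (J + (x)) + dim A ⧸ (J + (y))` (the exact sequence
`0 → A⧸(J + (y)) →·x A⧸(J + (x·y)) → A⧸(J + (x)) → 0`). [folklore] -/
theorem finrank_quotient_sup_span_mul_eq (J : Ideal A) (x y : A)
    (hx : ∀ r : A, x * r ∈ J → r ∈ J) [Module.Finite κ (A ⧸ (J ⊔ Ideal.span {x * y}))] :
    finrank κ (A ⧸ (J ⊔ Ideal.span {x * y})) =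
      finrank κ (A ⧸ (J ⊔ Ideal.span {x})) + finrank κ (A ⧸ (J ⊔ Ideal.span {y})) := by
  have h := finrank_quotient_eq_colon_add (κ := κ) (J ⊔ Ideal.span {x * y}) x
  rw [colon_sup_span_mul_eq J y hx, sup_span_mul_sup_span_eq] at h
  rw [h, add_comm]

/-- `(J + (x))·(J + (y)) ≤ J + (x·y)`. [folklore] -/
theorem sup_span_mul_sup_span_le (J : Ideal A) (x y : A) :
    (J ⊔ Ideal.span {x}) * (J ⊔ Ideal.span {y}) ≤ J ⊔ Ideal.span {x * y} := by
  rw [Ideal.sup_mul, Ideal.mul_sup, Ideal.mul_sup, Ideal.span_singleton_mul_span_singleton]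
  exact sup_le (sup_le (Ideal.mul_le_right.trans le_sup_left)
    (Ideal.mul_le_right.trans le_sup_left))
    (sup_le (Ideal.mul_le_left.trans le_sup_left) le_sup_right)

/-- `Ideal.ofList (List.ofFn g)` is the ideal generated by the range of `g`. [folklore] -/
theorem ofList_ofFn {k : ℕ} (g : Fin k → A) :
    Ideal.ofList (List.ofFn g) = Ideal.span (Set.range g) :=
  congr_arg Ideal.span (Set.ext fun r => by rw [Set.mem_setOf_eq, List.mem_ofFn'])

end Algebra

/-! ## Power series: `x` is a non-zero-divisor modulo `(g₁, …, g_k)` -/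

section PowerSeries

variable {n k : ℕ} {L : Type} [Field L]

/-- **`x` is regular modulo `(g)`.** In `R = L⟦u₁, …, uₙ⟧`, if `k < n` and `R ⧸ (g₁, …, g_k, x)` is
finite over `L`, then `x·r ∈ (g) ⇒ r ∈ (g)`: either a unit is among `g₁, …, g_k, x` (trivial), or
they lie in `𝔪` and generate an `𝔪`-primary ideal, so that by Krull `k + 1 = n` and
`g₁, …, g_k, x` is a system of parameters of the regular local ring `R`, hence a regular sequence.
[cite: Matsumura1987, Thm. 17.4 (iii)] -/
theorem mem_of_mul_mem (hkn : k < n) (g : Fin k → MvPowerSeries (Fin n) L)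
    (x : MvPowerSeries (Fin n) L)
    [Module.Finite L (MvPowerSeries (Fin n) L ⧸ (Ideal.span (Set.range g) ⊔ Ideal.span {x}))]
    (r : MvPowerSeries (Fin n) L) (hr : x * r ∈ Ideal.span (Set.range g)) :
    r ∈ Ideal.span (Set.range g) := by
  haveI : IsRegularLocalRing (MvPowerSeries (Fin n) L) := isRegularLocalRing_mvPowerSeries L (Fin n)
  by_cases hu : ∃ q ∈ List.ofFn g ++ [x], IsUnit q
  · obtain ⟨q, hq, hqu⟩ := hu
    rw [List.mem_append, List.mem_ofFn', List.mem_singleton] at hq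
    rcases hq with ⟨i, rfl⟩ | rfl
    · rw [Ideal.eq_top_of_isUnit_mem _ (Ideal.subset_span (Set.mem_range_self i)) hqu]
      exact Submodule.mem_top
    · obtain ⟨u, rfl⟩ := hqu
      have h := Ideal.mul_mem_left _ (↑u⁻¹ : MvPowerSeries (Fin n) L) hr
      rwa [Units.inv_mul_cancel_left] at h
  · push Not at hu
    have hQm : ∀ q ∈ List.ofFn g ++ [x], q ∈ maximalIdeal (MvPowerSeries (Fin n) L) :=
      fun q hq => (mem_nonunits_iff).mpr (hu q hq)
    obtain ⟨N, hN⟩ := exists_maximalIdeal_pow_le_of_finite_quotient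
      (Ideal.span (Set.range g) ⊔ Ideal.span {x})
    have hofList :
        Ideal.ofList (List.ofFn g ++ [x]) = Ideal.span (Set.range g) ⊔ Ideal.span {x} := by
      rw [Ideal.ofList_append, Ideal.ofList_singleton, ofList_ofFn]
    rw [← hofList] at hN
    have hlen : (List.ofFn g ++ [x]).length = k + 1 := by
      rw [List.length_append, List.length_ofFn, List.length_singleton]
    have hdim : ringKrullDim (MvPowerSeries (Fin n) L) = n := by
      rw [ringKrullDim_mvPowerSeries, Nat.card_eq_fintype_card, Fintype.card_fin]
    rcases Nat.lt_or_ge (k + 1) n with hlt | hge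
    · -- vacuous: Krull forces `n ≤ k + 1`
      exfalso
      have h := ringKrullDim_le_length_of_maximalIdeal_pow_le hQm hN
      rw [hdim, hlen] at h
      have h' : n ≤ k + 1 := by exact_mod_cast h
      omega
    · have hkn' : k + 1 = n := le_antisymm hkn hge
      have hreg := isRegular_of_maximalIdeal_pow_le_ofList hQm (by rw [hdim, hlen, hkn']) hN
      have h2 := ((isWeaklyRegular_append_iff (MvPowerSeries (Fin n) L) (List.ofFn g) [x]).mp
        hreg.toIsWeaklyRegular).2
      rw [isWeaklyRegular_singleton_iff, isSMulRegular_quotient_iff_mem_of_smul_mem] at h2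
      have hI : (Ideal.ofList (List.ofFn g) • ⊤ : Submodule (MvPowerSeries (Fin n) L)
          (MvPowerSeries (Fin n) L)) = Ideal.span (Set.range g) := by
        rw [ofList_ofFn, Ideal.smul_eq_mul, Ideal.mul_top]
      rw [hI] at h2
      exact h2 r (by rw [smul_eq_mul]; exact hr)

/-- **`R ⧸ (g, x·y)` is finite** when `R ⧸ (g, x)` and `R ⧸ (g, y)` are: `(g, x)·(g, y) ≤ (g, x·y)`
contains a power of the maximal ideal. [folklore] -/
theorem finite_quotient_sup_span_mul {σ : Type*} [Finite σ] (J : Ideal (MvPowerSeries σ L))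
    (x y : MvPowerSeries σ L)
    [Module.Finite L (MvPowerSeries σ L ⧸ (J ⊔ Ideal.span {x}))]
    [Module.Finite L (MvPowerSeries σ L ⧸ (J ⊔ Ideal.span {y}))] :
    Module.Finite L (MvPowerSeries σ L ⧸ (J ⊔ Ideal.span {x * y})) := by
  obtain ⟨N, hN⟩ := exists_maximalIdeal_pow_le_of_finite_quotient (J ⊔ Ideal.span {x})
  obtain ⟨N', hN'⟩ := exists_maximalIdeal_pow_le_of_finite_quotient (J ⊔ Ideal.span {y})
  have hK : maximalIdeal (MvPowerSeries σ L) ^ (N + N') ≤ J ⊔ Ideal.span {x * y} := by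
    rw [pow_add]
    exact (Ideal.mul_mono hN hN').trans (sup_span_mul_sup_span_le J x y)
  haveI := finite_quotient_maximalIdeal_pow (σ := σ) (K := L) (N + N')
  exact finite_quotient_of_le (κ := L) hK

end PowerSeries

end PolarAdditivity

open PolarAdditivity in
/-- **Stub S4: polar additivity.** In `R = L⟦u₁, …, uₙ⟧`, for `k < n` series `g₁, …, g_k` and
`x, y` with `R ⧸ (g, x)` and `R ⧸ (g, y)` finite over `L`:
`dim_L R ⧸ (g, x·y) = dim_L R ⧸ (g, x) + dim_L R ⧸ (g, y)`. Vacuous unless `k + 1 = n` or a unit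
is among `g, x` (Krull); then `x` is regular modulo `(g)` (a system of parameters of the regular
local ring `R` is a regular sequence) and `0 → R⧸(g, y) →·x R⧸(g, x·y) → R⧸(g, x) → 0` is exact.
[folklore] -/
theorem stub_polarAdditivity :
    ∀ (n k : ℕ), k < n → ∀ (L : Type) [Field L]
      (g : Fin k → MvPowerSeries (Fin n) L) (x y : MvPowerSeries (Fin n) L),
      Module.Finite L (MvPowerSeries (Fin n) L ⧸ (Ideal.span (Set.range g) ⊔ Ideal.span {x})) →
      Module.Finite L (MvPowerSeries (Fin n) L ⧸ (Ideal.span (Set.range g) ⊔ Ideal.span {y})) →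
      Module.finrank L (MvPowerSeries (Fin n) L ⧸ (Ideal.span (Set.range g) ⊔ Ideal.span {x * y})) =
        Module.finrank L (MvPowerSeries (Fin n) L ⧸ (Ideal.span (Set.range g) ⊔ Ideal.span {x})) +
        Module.finrank L (MvPowerSeries (Fin n) L ⧸ (Ideal.span (Set.range g) ⊔ Ideal.span {y})) := by
  intro n k hkn L _ g x y hfx hfy
  haveI := finite_quotient_sup_span_mul (Ideal.span (Set.range g)) x y
  exact finrank_quotient_sup_span_mul_eq (Ideal.span (Set.range g)) x y
    (fun r hr => mem_of_mul_mem hkn g x r hr)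

end Summit.ResolutionOfSingularities.ResolutionOfSingularities.Theorems.JacobianBudget

end
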